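import Summits.QuantumFields.BalabanUV.Beta.GAN24.LegChainPushBound
import Summits.QuantumFields.BalabanUV.Beta.GAN24.LegPushDressedBound

/-!
# `BalabanUV.Beta.GAN24.LegChainPushDressed` — binder row G-an2-4 ∕ (CONV-C), W-slot, the (α-0) parity re-cut, located crux (Q-L-k₀) (RULING R-gan24p1-g36-1):
# **THE k₀-FOLD (H1♮) WINDOW MODULO ENVELOPES, DRESSED SLOT LEGS** — `LegChainPushBound` ∘ `LegPushDressedBound` — and the scalar pin `|Π kc| ≤ L^{3(d+1)}`.

* **`locStencil₂_legChain_bsumPow_of_dressed_envelopes`**: kernels `K j` decaying at positive rates, `N ≥ 1`, a table with `LocStencil₂ W C δ`, bounded, with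
  slot-CHARGE rows `g` and slot-DIVERGENCE rows `g′`; at blocking `L = N^{k+1}`: IF the composite slot leg is a dressed leg,
  `Push4Iter.legChain (colH ∘ K) m k = r + d_zφ` with `r` of sup envelope `a`, unit gradient `a′`, and `φ` of sup envelope `a_φ` (all `·e^{−κ₀‖quo L · − y‖∞}`), and the
  composite kernel leg `kChain (krow ∘ K) m k` has sup envelope `a_ρ`, `0 < κ₀ ≤ (δ/6)·L`, THEN
  `LocStencil₂ (legChain kc K N m (k+1) (bsumPow N (k+1) ∘ W)) (|Π_{j<k+1} kc (m+j)|·(C_bare + C_gauge)) (κ₀/(18(d+1)))`,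
  `C_bare = |Fib d|(d+1)²·a_ρ·Jc·L^{d+1}·Zl(κ₀/(2(d+1)))` (`LegStepPush`), `C_gauge = |Fib d|·a_ρ·g′·(d+1)(2a·a_φ + a_φ²(e^{3δ}+1))·e^{5κ₀}Zl(δ/2)³·L^{d+1}·Zl(κ₀/(2(d+1)))`.
* `abs_kcPin_le`, **`abs_prod_kcPin_le`**: for the socket's scalar `kc _ := −(c·Lc^{2(d+1)}·(Lc^{d+1})⁻¹)` under the pin `|c| ≤ Lc^{2(d+1)}` (`1 ≤ Lc`):
  `|Π_{j<k+1} kc (m+j)| ≤ (Lc^{k+1})^{3(d+1)} = L^{3(d+1)}`.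
What remains for (H1♮): the identification of the socket's composite DRESSED slot legs as `r + d_zφ` with leaf-12's envelopes ((b1), (E-c)), the OWNER gan24-p1's
block-ℓ¹ rows for the dressed KERNEL leg in place of the sup envelope `a_ρ` ((E-b)), his `LegWindowArithmetic` for `θ < 1`, and the socket call ((E-d)).

NOT IN PRINT; OUR PROOF ([folklore]; 0 `def`, 0 cited facts, 0 `def … : Prop`, 0 sorry, 0 wall binders).  HONEST FRAMING (cell contract, verbatim): «discharging
`BetaPertH` makes Bałaban's UV stability UNCONDITIONAL — a real constructive-QFT result; it is NOT the continuum limit and NOT the Clay problem.»  HONEST DEPENDENCY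
(verbatim): «continuum YM on T⁴ ⇐ BetaPertH ∧ nine spine estimates (0/9 proved); BetaPertH ⇐ (D1) ∧ (D4) ∧ CAP+tail; G-an2-4 gates asym, D1 and NE2/3/4.»
NOT (H1♮); NEVER «G-an2-4 closed» as (CONV-C); NOT D1, NOT `BetaPertH`, NOT continuum, NOT Clay; not in print.
Unit `b2b-balaban-gan24-formalise-leaf-01` (G-an2-4 formalisation swarm, leaf prover 01, gen 74), 2026-08-23.
-/

noncomputable section

open Finset
open scoped BigOperators
open Literature.MathematicalPhysics.QuantumFieldTheory.LatticeForm (quo)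
open Literature.MathematicalPhysics.QuantumFieldTheory.Balaban1983to89
open Literature.MathematicalPhysics.QuantumFieldTheory.Balaban1983to89.Beta
open B4ContourShift (supNorm)
open B6BondElimination (unitVec)
open B12Sec2to5 (l1 l1_nonneg)
open ExpKernelCalculus (MKer Decays Zl Zl_nonneg Zl_pos)
open OneStepResolventKernel (Fib)
open OneStepKernelFamily (colH)
open AffineAveraging (box toSite)
open BalabanCompositeJets (LocStencil₂ LocStencil₂.nonneg)
open BalabanStepW2 (locStencil₂_smul')
open Summit.QuantumFields.BalabanUV.Beta.GAN24.BiStencilZeroMode (Tab)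
open Summit.QuantumFields.BalabanUV.Beta.GAN24.Lin4LegTower (bsum)
open Summit.QuantumFields.BalabanUV.Beta.GAN24.Lin4LegTowerUnroll (bsumPow)
open Summit.QuantumFields.BalabanUV.Beta.GAN24.LegStepPush (krow legPush)
open Summit.QuantumFields.BalabanUV.Beta.GAN24.LegChainPush (kChain)
open Summit.QuantumFields.BalabanUV.Beta.GAN24.LegChainPushBound (legChain_bsumPow_eq_smul_legPush_bsum)
open Summit.QuantumFields.BalabanUV.Beta.GAN24.LegPushDressedBound (locStencil₂_legPush_dressed_bsum)

namespace Summit.QuantumFields.BalabanUV.Beta.GAN24.LegChainPushDressed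

variable {d : ℕ}

section Window

variable {K : ℕ → MKer (d + 1) (Fib d)} {N : ℕ} {kc : ℕ → ℝ} {W : Tab d} {C δ : ℝ}
  {L : ℕ} {κ₀ a a' aφ aρ g g' CW : ℝ}
  {r : Fin (d + 1) → (Fin (d + 1) → ℤ) → Fin (d + 1) → (Fin (d + 1) → ℤ) → ℝ}
  {φ : Fin (d + 1) → (Fin (d + 1) → ℤ) → (Fin (d + 1) → ℤ) → ℝ}

/-- NOT IN PRINT; OUR PROOF.  **THE k₀-FOLD WINDOW MODULO ENVELOPES, DRESSED SLOT LEGS** (as displayed in the module docstring). -/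
theorem locStencil₂_legChain_bsumPow_of_dressed_envelopes (hN : 1 ≤ N) (hK : ∀ j, ∃ C m : ℝ, 0 < m ∧ Decays (K j) C m)
    (hW : LocStencil₂ W C δ) (hδ : 0 < δ) (m k : ℕ) (hL : L = N ^ (k + 1)) (hκ : 0 < κ₀) (hgap : κ₀ ≤ δ / 6 * L)
    (ha : 0 ≤ a) (ha' : 0 ≤ a') (haφ : 0 ≤ aφ) (haρ : 0 ≤ aρ) (hg : 0 ≤ g) (hg' : 0 ≤ g')
    (hE : Push4Iter.legChain (fun j => colH (K j) N) m k = fun μ y κ v => r μ y κ v + (φ μ y (v + unitVec κ) - φ μ y v))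
    (hr : ∀ μ y κ v, |r μ y κ v| ≤ a * Real.exp (-(κ₀ * supNorm (quo L v - y))))
    (hr' : ∀ μ y κ v i, |r μ y κ (v + Pi.single i 1) - r μ y κ v| ≤ a' * Real.exp (-(κ₀ * supNorm (quo L v - y))))
    (hφ : ∀ μ y v, |φ μ y v| ≤ aφ * Real.exp (-(κ₀ * supNorm (quo L v - y))))
    (hl : ∀ α x' f x, |kChain (fun j => krow (K j) N) m k α x' f x| ≤ aρ * Real.exp (-(κ₀ * supNorm (quo L x - x'))))
    (hWb : ∀ κ u κ' u' x z a b, |W κ u κ' u' x z a b| ≤ CW)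
    (hq₂ : ∀ κ₁ v κ₂ x p f b, |∑' v', W κ₁ v κ₂ v' x p f b| ≤ g * Real.exp (-δ * (l1 (x - v) + l1 (p - v))))
    (hq₁ : ∀ κ₁ κ₂ v' x p f b, |∑' v, W κ₁ v κ₂ v' x p f b| ≤ g * Real.exp (-δ * (l1 (x - v') + l1 (p - v'))))
    (hq₁₂ : ∀ κ₁ κ₂ x p f b, |∑' v, ∑' v', W κ₁ v κ₂ v' x p f b| ≤ g * Real.exp (-δ * l1 (p - x)))
    (hD₂ : ∀ κ v w x p f b, |∑ μ, (W κ v μ (w - unitVec μ) x p f b - W κ v μ w x p f b)|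
      ≤ g' * Real.exp (-δ * l1 (w - v)) * Real.exp (-δ * (l1 (x - v) + l1 (p - v))))
    (hD₁ : ∀ κ' w v' x p f b, |∑ κ, (W κ (w - unitVec κ) κ' v' x p f b - W κ w κ' v' x p f b)|
      ≤ g' * Real.exp (-δ * l1 (v' - w)) * Real.exp (-δ * (l1 (x - w) + l1 (p - w)))) :
    LocStencil₂ (Lin4LegTowerUnroll.legChain kc K N m (k + 1) (fun κ u κ' u' => bsumPow N (k + 1) (W κ u κ' u')))
      (|∏ j ∈ Finset.range (k + 1), kc (m + j)| *
        ((Fintype.card (Fib d) : ℝ) * ((d : ℝ) + 1) ^ 2 *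
          (aρ * ((Real.exp κ₀ * Zl (d + 1) (δ / 6)) *
            (a' ^ 2 * C * Real.exp κ₀ ^ 2 * (2 / (δ / 6) * Zl (d + 1) (δ / 6 / 2)) ^ 2
              + 2 * (a * a' * g * Real.exp κ₀ * (2 / (δ / 6) * Zl (d + 1) (δ / 6 / 2))) + a ^ 2 * g)) *
          ((L : ℝ) ^ (d + 1) * Zl (d + 1) (κ₀ / (2 * ((d : ℝ) + 1)))))
         + (Fintype.card (Fib d) : ℝ) * (aρ * g' * (((d : ℝ) + 1) * (2 * (a * aφ) + aφ * aφ * (Real.exp δ ^ 3 + 1))) *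
          (Real.exp κ₀ ^ 5 * Zl (d + 1) (δ / 2) ^ 3 * ((L : ℝ) ^ (d + 1) * Zl (d + 1) (κ₀ / (2 * ((d : ℝ) + 1))))))))
      (κ₀ / 3 / (6 * ((d : ℝ) + 1))) := by
  have hL1 : 1 ≤ L := by rw [hL]; exact Nat.one_le_pow _ _ hN
  rw [legChain_bsumPow_eq_smul_legPush_bsum hN hK hW hδ m k, ← hL, hE]
  exact locStencil₂_smul' _
    (locStencil₂_legPush_dressed_bsum hL1 hκ hδ hgap ha ha' haφ haρ hg hg' hr hr' hφ hl hW hWb hq₂ hq₁ hq₁₂ hD₂ hD₁)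

end Window

/-! ## The scalar pin -/

/-- [folklore] **THE ONE-STEP SCALAR UNDER THE PIN**: `|c| ≤ Lc^{2(d+1)}`, `1 ≤ Lc` ⟹ `|−(c·Lc^{2(d+1)}·(Lc^{d+1})⁻¹)| ≤ Lc^{3(d+1)}`. -/
theorem abs_kcPin_le {Lc : ℕ} (hLc : 1 ≤ Lc) {c : ℝ} (hc : |c| ≤ (Lc : ℝ) ^ (2 * (d + 1))) :
    |-((c * (Lc : ℝ) ^ (2 * (d + 1))) * ((Lc : ℝ) ^ (d + 1))⁻¹)| ≤ (Lc : ℝ) ^ (3 * (d + 1)) := by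
  have hL0 : (0 : ℝ) < Lc := by exact_mod_cast hLc
  have hp : (0 : ℝ) < (Lc : ℝ) ^ (d + 1) := by positivity
  rw [abs_neg, abs_mul, abs_mul, abs_inv, abs_of_pos hp, abs_of_nonneg (by positivity : (0 : ℝ) ≤ (Lc : ℝ) ^ (2 * (d + 1)))]
  rw [show (Lc : ℝ) ^ (3 * (d + 1)) = (Lc : ℝ) ^ (2 * (d + 1)) * (Lc : ℝ) ^ (2 * (d + 1)) * ((Lc : ℝ) ^ (d + 1))⁻¹ by
    rw [show 2 * (d + 1) = (d + 1) + (d + 1) by ring, show 3 * (d + 1) = (d + 1) + (d + 1) + (d + 1) by ring, pow_add, pow_add]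
    field_simp]
  gcongr

/-- [folklore] **THE k₀-FOLD SCALAR UNDER THE PIN**: `|Π_{j<k+1} kc (m+j)| ≤ (Lc^{k+1})^{3(d+1)}` for the constant socket scalar
`kc _ := −(c·Lc^{2(d+1)}·(Lc^{d+1})⁻¹)`, `|c| ≤ Lc^{2(d+1)}`, `1 ≤ Lc` — i.e. `≤ L^{3(d+1)}` at blocking `L = Lc^{k+1}`. -/
theorem abs_prod_kcPin_le {Lc : ℕ} (hLc : 1 ≤ Lc) {c : ℝ} (hc : |c| ≤ (Lc : ℝ) ^ (2 * (d + 1))) (m k : ℕ) :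
    |∏ j ∈ Finset.range (k + 1), (fun _ : ℕ => -((c * (Lc : ℝ) ^ (2 * (d + 1))) * ((Lc : ℝ) ^ (d + 1))⁻¹)) (m + j)|
      ≤ (((Lc ^ (k + 1) : ℕ) : ℝ)) ^ (3 * (d + 1)) := by
  rw [Finset.prod_const, Finset.card_range, abs_pow, Nat.cast_pow, ← pow_mul,
    show (k + 1) * (3 * (d + 1)) = 3 * (d + 1) * (k + 1) by ring, pow_mul (Lc : ℝ) (3 * (d + 1)) (k + 1)]
  exact pow_le_pow_left₀ (abs_nonneg _) (abs_kcPin_le hLc hc) _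

end Summit.QuantumFields.BalabanUV.Beta.GAN24.LegChainPushDressed

end
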